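import Mathlib.Tactic.DeriveFintype
import Mathlib.Data.Fintype.Basic
import Mathlib.Tactic.IntervalCases
import HarnessLib

/-!
# Venture HSemireg — kernel index of the «landing degree» remark (W5 seat w5-n6-2 gen 16, UNIVERSAL-w5n62g16 §5 (2a))

Companion to `UnionSlotCount.lean` (THEOREM U). The census model of the W5 Koszul-frame census uses only
binary Yoneda products (m₂). §5 (2a) of the note `widen/W5/UNIVERSAL-w5n62g16.md` argues that on this
frame no higher A∞ product `μ_n` (n ≥ 3) can enter the twisted differential in total degrees ≤ 1 or the
Maurer–Cartan equation: a product with `k` arguments of Ext-degree 6 lands in Ext-degree `6k + 2 − n`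
(+ the variable's own Ext-degree `e_x ∈ {0, 6}`), which between distinct tautological pieces is non-zero
only in degrees 0 and 6, while the link graphs have no composable chain of four links, so `n ≤ 7` for
products through one variable, `n ≤ 4` for products returning to the same piece, `n ≤ 3` for pure link
products. This file checks the FINITE part in the kernel:

* `no_chain_of_four`: the link graphs of the four placement types (α), (β), (δ), (γ) on the six piece
  kinds have no composable chain of four links (`decide`); `chain_of_three_exists`: the bound is sharp;
* `no_open_landing`, `no_closed_landing`, `no_mc_landing`: the resulting ranges of `n` admit no
  admissible landing degree (`omega`).

HONEST FRAMING: finite combinatorics and integer arithmetic only. That Ext between distinct tautological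
pieces of a ppav lives in one degree ∈ {0, 6}, that `μ_n` has degree `2 − n`, and the identification of the
graphs below with the link families of the 81 residue shapes live in the note (hand ×1 there), not here.
Nothing in this file says that HC, HC_CM or HC_AV holds; count-neutral for the cell's doors.
-/

namespace Summit.Ventures.HSemireg

namespace UnionSlotLanding

/-- the six piece kinds of the Koszul frame: `A = O(−4Θ)`, `B = O(−3Θ)P_j`, `C = E_{−1∕2}`,
`Cp = E_{1∕2}`, `Bp = O(3Θ)Q_k`, `Ap = O(4Θ)` (members of a block have identical links). -/
inductive Piece | A | B | C | Cp | Bp | Ap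
  deriving DecidableEq, Fintype, Repr

/-- the four placement types of the 81 residue shapes (RESIDUE81-w5n62g12 §1). -/
inductive Ty | alpha | beta | delta | gamma
  deriving DecidableEq, Fintype, Repr

open Piece Ty in
/-- the PRESENT link families (degree-1 Maurer–Cartan data) of each type, as a directed graph on piece
kinds: (α) t′: A→B, u: B→C, z: B→B′, c: C→C′, ℓ′: C→A′, t: B′→A′; (β) t′, ℓ: A→C′, z, c, w′: C′→B′, t;
(δ) t′, u, c, t, ε: B′ ⇒ B, λ: A′ ⇒ C; (γ) t′, c, w′, t, ε: B′ ⇒ B, ψ′: C′ ⇒ A. -/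
def link : Ty → Piece → Piece → Bool
  | alpha, A, B => true | alpha, B, C => true | alpha, B, Bp => true | alpha, C, Cp => true
  | alpha, C, Ap => true | alpha, Bp, Ap => true
  | beta, A, B => true | beta, A, Cp => true | beta, B, Bp => true | beta, C, Cp => true
  | beta, Cp, Bp => true | beta, Bp, Ap => true
  | delta, A, B => true | delta, B, C => true | delta, C, Cp => true | delta, Bp, Ap => true
  | delta, Bp, B => true | delta, Ap, C => true
  | gamma, A, B => true | gamma, C, Cp => true | gamma, Cp, Bp => true | gamma, Bp, Ap => true
  | gamma, Bp, B => true | gamma, Cp, A => true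
  | _, _, _ => false

/-- **No composable chain of four links** in any of the four types (hence the link graphs are acyclic
and the longest chain has three links). -/
theorem no_chain_of_four (t : Ty) (a b c d e : Piece) :
    ¬ (link t a b = true ∧ link t b c = true ∧ link t c d = true ∧ link t d e = true) := by
  revert t a b c d e; decide

/-- chains of three links do occur (the bound is sharp): (δ) B′ → A′ ⇒ C → C′. -/
theorem chain_of_three_exists :
    link Ty.delta Piece.Bp Piece.Ap = true ∧ link Ty.delta Piece.Ap Piece.C = true ∧
      link Ty.delta Piece.C Piece.Cp = true := by decide

/-- LANDING DEGREE, open chains: a product `μ_n` through one variable has `3 ≤ n ≤ 7`; with `k`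
Ext⁶-arguments and a variable of Ext-degree `e_x ∈ {0,6}`, a non-zero group between distinct pieces
needs `e_x + 6k + 2 − n ∈ {0, 6}` — impossible. -/
theorem no_open_landing (n k ex : ℕ) (hn : 3 ≤ n) (hn' : n ≤ 7) (hex : ex = 0 ∨ ex = 6)
    (hland : ex + 6 * k + 2 = n ∨ ex + 6 * k + 2 = n + 6) : False := by
  omega

/-- LANDING DEGREE, closed chains (target `Ext^e(X,X) = H^e(𝒪_X)`): `3 ≤ n ≤ 4`; a degree-1 variable
needs `e = 2`, i.e. `n = e_x + 6k`; a degree-0 variable needs `e = 1`, i.e. `n = e_y + 6k + 1` —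
impossible. -/
theorem no_closed_landing (n k ex : ℕ) (hn : 3 ≤ n) (hn' : n ≤ 4) (hex : ex = 0 ∨ ex = 6)
    (hland : n = ex + 6 * k ∨ n = ex + 6 * k + 1) : False := by
  omega

/-- LANDING DEGREE, the Maurer–Cartan equation: `μ_n(δ,…,δ)` with `n ≥ 3` links has `n ≤ 3` and
would land in Ext-degree `6k + 2 − n` between distinct pieces — never `0` or `6`. -/
theorem no_mc_landing (n k : ℕ) (hn : 3 ≤ n) (hn' : n ≤ 3)
    (hland : 6 * k + 2 = n ∨ 6 * k + 2 = n + 6) : False := by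
  omega

end UnionSlotLanding

end Summit.Ventures.HSemireg
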